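import Literature.MathematicalPhysics.QuantumFieldTheory.Balaban1983to89.B16Eq18Proof

/-!
# `Balaban1983to89.B16Ineq18AxialGauge` — T. Bałaban, *Large field renormalization. II. Localization, exponentiation, and
bounds for the 𝐑 operation*, Commun. Math. Phys. **122** (1989) 355–392 [Balaban1989LargeFieldII], Sect. 1 p. 358, the printed
aside after (1.8): *«For example, if in this domain Λ we fix an axial gauge in the direction of x₁-axis, i.e., we put
B′((x − e₁, x)) = 0 for x ∈ Λ, then the inequality (1.8) holds with the constant (100M)³»* — THE `x₁`-AXIAL GAUGE VERSION OF THE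
POINCARÉ INEQUALITY (1.8), PROVED at the `ℤ^d` level of `B16Eq18Proof` (cell GAPS G-r2.9: *«the printed aside "(100M)³ for the
x₁-axial gauge" is not touched»* there): the two telescoping identities of the `x₁`-axial gauge (ladders in the `(x₁, x_μ)`-planes for
the bonds of directions `μ ≠ 1`; walks along the top `x₁`-face for the free `x₁`-bonds), the resulting POINTWISE bounds (absolute and
squared, Cauchy–Schwarz), the SUP-FORM `|B(b)| ≤ (K² + 2K)·sup_p |(∂B)(p)|`, and THE `ℓ²` FORM
`Σ_b |B(b)|² ≤ (3K² + 2K⁴)·Σ_p |(∂B)(p)|²` for a box of sides `≤ K` (`ineq18_axial`).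

statement-level skeleton of published theorems with citation tags; proofs where landed; nothing here is a claim about
the Yang–Mills mass gap

Cell pub-ymgap, HUMAN RULING D-0062 (Track A full width), seat `pub-ymgap-dag-n12-c` (R134 acceleration seat (a), strategy s1 of
DAG node N12 = [B15]; generation g2, seventh product — the (1.8)/(1.9) input (m1) of the Proposition-1 assembly AT THE `x₁`-AXIAL
SLICE of `B15Prop1CarrierOnSU2Box`, whose variables are the bonds MEETING `Λ`).  PDF held: `paper:balaban1989-cmp122-large-field-ii`
(journal page = PDF page + 354; p. 358 = PDF 4, text layer re-read by this seat 2026-08-26).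

THE SETTING (conventions of `B6TreeGaugePoincare` ∕ `B16Eq18Proof`: 0-indexed directions, print's `x₁` = index `0`; a bond
`(z, μ) = ⟨z, z + e_μ⟩`; `curl B z j μ = B(z,j) + B(z+e_j, μ) − B(z+e_μ, j) − B(z, μ)`; `Λ = box n y`, sides `n_i ≤ K`).  The
VARIABLES of [IV] (1.77) are the bonds MEETING `Λ` (p. 195 *«bonds intersecting ∂Λ belong to 𝔹₀»*; `B15Prop1Carrier.extSet`): `B = 0`
on the bonds with both ends off `Λ` (hypothesis `hout`).  THE GAUGE: `B(⟨x − e₁, x⟩) = 0` for `x ∈ Λ` (hypothesis `hax`) — ALL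
`x₁`-bonds ending in `Λ`, including the ones entering through the bottom `x₁`-face (print's external bonds: the gauge is complete,
`|G₀| = |Λ|`).  Consequently (§1) an `x₁`-bond carries a possibly non-zero variable ONLY if it EXITS `Λ` through the top
`x₁`-face.

WHAT THIS FILE PROVES (theorems only; Mathlib + `B16Eq18Proof`; no `sorry`, no definition, no `… : Prop` fact; axioms standard).
§1 `dir0_eq_zero` (the `x₁`-bonds vanish unless they exit the top face); `step_ladder` (one rung: `B(z + e₁, μ) = B(z, μ) +
   curl B z 0 μ` when the two `x₁`-bonds of the plaquette vanish); `ladder_eq_sum` (for `μ ≠ 0`: `B(w, μ) = Σ_{s<m} curl B (w − (m−s)e₁)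
   0 μ`, `m = w₁ − y₁ + 1`, the telescoping from below the box where the variable is frozen); `face_step`, `face_eq_sum` (for `x` on
   the top face: `B(x, 0) = Σ_{j<J} [curl B (x + je₂) 0 1 + B(x + je₂, 1)]`, `J = y₂ + n₂ − x₂`, the walk along the face in the
   direction `e₂` until the variable is frozen; `d ≥ 2`).
§2 POINTWISE BOUNDS: `abs_ladder_le` (`|B(w,μ)| ≤ K·S` for `μ ≠ 0`), `abs_face_le` (`|B(x,0)| ≤ (K + K²)·S`), and **`abs_le_axial`**:
   `|B(b)| ≤ (K² + 2K)·S` for EVERY bond, `S` any bound of `|curl B|` — the SUP-FORM of the `x₁`-axial (1.8).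
§3 SQUARED POINTWISE BOUNDS: `sq_ladder_le` (`B(z + m•e₁, μ)² ≤ m·Σ_{s<m} (curl B …)²`, `sq_sum_le_card_mul_sum_sq`), `sq_face_le`
   (`B(x,0)² ≤ 2J·Σ_j (curl …)² + 2J·Σ_j B(x + je₂, 1)²`).
§4 THE `ℓ²` FORM: `mem_bigBox_of_ne` (the variables issue from `box (n+2) (y−1)`), `mem_plaqBox_of_ne` (the `(x₁,x_μ)`-plaquette
   variables issue from `box (n+3) (y−2)`), the uniform squared bounds `sq_le_uniform_of_ne` ∕ `sq_dir0_le_uniform` (ladder ∕ face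
   sums extended to `K` terms), and **`ineq18_axial`**: `Σ_{z ∈ box (n+2)(y−1)} Σ_μ B(z,μ)² ≤ (3K² + 2K⁴)·Σ_{z ∈ box (n+3)(y−2)} Σ_μ
   (curl B z 0 μ)²` — summing the uniform bounds over the enlarged box and dominating every translated ladder ∕ face sum by the full
   plaquette sum (translation-injectivity + support, `sum_shift_le`); `const_le_printed` + **`ineq18_axial_printed`** — the same in
   the printed shape `B16Sect1Wilson.Ineq18 (Σ_b B²) (Σ_p (∂B)²) d M` for `d ≥ 4` (print's `d = 4`), sides `≤ 100M`;
   **`ineq18_axial_vec`** — the 𝔤-valued form, componentwise in an orthonormal basis (as `B16Eq18Proof.ineq18_box_vec`).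

HONEST SCOPE.  (i) Constant: `3K² + 2K⁴` by this route (print: *«(100M)³»*; p. 358 *«with different constants»* — for (1.9)'s use any
constant `≤ d(100M)^{d+1}` serves, and `5K⁴ ≤ 4·(100M)⁵` at `K = 100M`); the sharper `K³` needs the finer count print alludes to.  (ii)
The two sums run over EXPLICIT enlarged boxes containing the supports (left: every bond carrying a variable; right: every
`(x₁, x_μ)`-plaquette with a non-zero circulation, the `μ = 0` terms being `0`) rather than over *«b ∈ Λ»*, *«p ∈ Λ»* literally — the
same numbers.  (iii) `ℤ^d` level (the torus transport is `T4AxialGaugeSmallField.castSite` bookkeeping as in `B15Prop1RelativeAxialGauge`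
§7); `d ≥ 2` (`d ≥ 4` for the printed-shape constant).  Count-neutral; NOT a discharge of N12
(it is the (1.8) half of (m1) = (1.9) at the `x₁`-axial slice of `B15Prop1CarrierOnSU2Box`; the (1.7) half is the p. 357 perturbation
letter); NOT summit progress.
-/

open Finset

namespace Literature.MathematicalPhysics.QuantumFieldTheory.Balaban1983to89.B16Ineq18AxialGauge

open B6BondElimination (unitVec unitVec_apply add_unitVec_apply)
open B6TreeGaugePoincare (Cfg curl)
open B16Eq18Proof (box mem_box)

noncomputable section

variable {d : ℕ} {n : Fin d → ℕ} {y : Fin d → ℤ}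

/-! ## §1 The telescoping identities of the `x₁`-axial gauge -/

section Identities

variable (h0 : 0 < d)

/-- Coordinates of `z + s•e_κ`. [folklore] -/
private theorem add_zsmul_unitVec_apply (z : Fin d → ℤ) (s : ℤ) (κ i : Fin d) :
    (z + s • unitVec κ) i = z i + if i = κ then s else 0 := by
  simp [unitVec_apply]

/-- **The `x₁`-bonds vanish unless they exit the top face.**  Under the gauge (`hax`: `B(⟨x − e₁, x⟩) = 0` for `x ∈ Λ`) and the
support (`hout`: `B = 0` on bonds with both ends off `Λ`), `B(z, 0) = 0` whenever it is NOT the case that `z ∈ Λ` and `z + e₁ ∉ Λ`.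
[cite: Balaban1989LargeFieldII, (1.8) p.358 («we put B′((x − e₁, x)) = 0 for x ∈ Λ»)] -/
theorem dir0_eq_zero (B : Cfg d) (hax : ∀ x ∈ box n y, B (x - unitVec ⟨0, h0⟩, ⟨0, h0⟩) = 0)
    (hout : ∀ (z : Fin d → ℤ) (μ : Fin d), z ∉ box n y → z + unitVec μ ∉ box n y → B (z, μ) = 0)
    {z : Fin d → ℤ} (hz : ¬ (z ∈ box n y ∧ z + unitVec ⟨0, h0⟩ ∉ box n y)) : B (z, ⟨0, h0⟩) = 0 := by
  by_cases h1 : z + unitVec ⟨0, h0⟩ ∈ box n y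
  · have := hax _ h1
    rwa [add_sub_cancel_right] at this
  · have h2 : z ∉ box n y := fun h => hz ⟨h, h1⟩
    exact hout z _ h2 h1

/-- **One rung of the ladder**: if the two `x₁`-bonds `⟨z, z+e₁⟩`, `⟨z+e_μ, z+e_μ+e₁⟩` of the plaquette at `z` in the
`(x₁, x_μ)`-plane vanish, then `B(z + e₁, μ) = B(z, μ) + (∂B)(p)`. [cite: Balaban1989LargeFieldII, (1.8) p.358] -/
theorem step_ladder (B : Cfg d) {z : Fin d → ℤ} {μ : Fin d} (h1 : B (z, ⟨0, h0⟩) = 0)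
    (h2 : B (z + unitVec μ, ⟨0, h0⟩) = 0) :
    B (z + unitVec ⟨0, h0⟩, μ) = B (z, μ) + curl B z ⟨0, h0⟩ μ := by
  simp only [curl, h1, h2]
  ring

/-- Along an `(x₁,x_μ)`-ladder ALL `x₁`-bonds below the top face vanish: for `z` with `y₁ − 1 ≤ z₁` and `z₁ + 1 < y₁ + n₁`
(so `z + e₁` has its `x₁`-coordinate in the box range), `B(z, 0) = 0`. [cite: Balaban1989LargeFieldII, (1.8) p.358] -/
theorem dir0_eq_zero_of_lt (B : Cfg d) (hax : ∀ x ∈ box n y, B (x - unitVec ⟨0, h0⟩, ⟨0, h0⟩) = 0)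
    (hout : ∀ (z : Fin d → ℤ) (μ : Fin d), z ∉ box n y → z + unitVec μ ∉ box n y → B (z, μ) = 0)
    {z : Fin d → ℤ} (hz : z ⟨0, h0⟩ + 1 < y ⟨0, h0⟩ + n ⟨0, h0⟩) : B (z, ⟨0, h0⟩) = 0 := by
  refine dir0_eq_zero h0 B hax hout fun ⟨hzin, hzout⟩ => hzout ?_
  rw [mem_box] at hzin ⊢
  intro i
  rw [add_unitVec_apply]
  by_cases hi : i = ⟨0, h0⟩
  · subst hi
    simp only [if_true]
    exact ⟨by linarith [(hzin ⟨0, h0⟩).1], hz⟩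
  · simp only [hi, if_false, add_zero]
    exact hzin i

/-- **THE LADDER IDENTITY.**  For `μ ≠ 0` and a base point `z` with `x₁`-coordinate `y₁ − 1` (just below the box): for every
`m ≤ n₁`, `B(z + m•e₁, μ) = B(z, μ) + Σ_{s<m} (∂B)(z + s•e₁; e₁, e_μ)` — all the intermediate `x₁`-bonds vanish by the gauge and
the support. [cite: Balaban1989LargeFieldII, (1.8) p.358] -/
theorem ladder_eq_sum (B : Cfg d) (hax : ∀ x ∈ box n y, B (x - unitVec ⟨0, h0⟩, ⟨0, h0⟩) = 0)
    (hout : ∀ (z : Fin d → ℤ) (μ : Fin d), z ∉ box n y → z + unitVec μ ∉ box n y → B (z, μ) = 0)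
    {μ : Fin d} (hμ : μ ≠ ⟨0, h0⟩) {z : Fin d → ℤ} (hz : z ⟨0, h0⟩ = y ⟨0, h0⟩ - 1) :
    ∀ m : ℕ, m ≤ n ⟨0, h0⟩ →
      B (z + (m : ℤ) • unitVec ⟨0, h0⟩, μ) =
        B (z, μ) + ∑ s ∈ range m, curl B (z + (s : ℤ) • unitVec ⟨0, h0⟩) ⟨0, h0⟩ μ := by
  intro m
  induction m with
  | zero => intro; simp
  | succ m ih =>
    intro hm
    have hm' : m ≤ n ⟨0, h0⟩ := Nat.le_of_succ_le hm
    have hlt : (z + (m : ℤ) • unitVec ⟨0, h0⟩) ⟨0, h0⟩ + 1 < y ⟨0, h0⟩ + n ⟨0, h0⟩ := by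
      rw [add_zsmul_unitVec_apply, if_pos rfl, hz]
      have : (m : ℤ) + 1 ≤ n ⟨0, h0⟩ := by exact_mod_cast hm
      linarith
    have h1 := dir0_eq_zero_of_lt h0 B hax hout hlt
    have hlt' : (z + (m : ℤ) • unitVec ⟨0, h0⟩ + unitVec μ) ⟨0, h0⟩ + 1 < y ⟨0, h0⟩ + n ⟨0, h0⟩ := by
      rw [add_unitVec_apply, if_neg hμ.symm, add_zero]
      exact hlt
    have h2 := dir0_eq_zero_of_lt h0 B hax hout hlt'
    have hstep := step_ladder h0 B h1 h2
    have hpt : z + ((m + 1 : ℕ) : ℤ) • unitVec ⟨0, h0⟩ = z + (m : ℤ) • unitVec ⟨0, h0⟩ + unitVec ⟨0, h0⟩ := by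
      rw [Nat.cast_succ, add_smul, one_smul, add_assoc]
    rw [hpt, hstep, ih hm', sum_range_succ, add_assoc]

/-- The base variable of a ladder is frozen: a bond whose initial point has `x₁`-coordinate `y₁ − 1` (below the box) and whose
direction is not `e₁` has both ends off `Λ`. [cite: Balaban1989LargeFieldII, (1.8) p.358] -/
theorem base_eq_zero (B : Cfg d)
    (hout : ∀ (z : Fin d → ℤ) (μ : Fin d), z ∉ box n y → z + unitVec μ ∉ box n y → B (z, μ) = 0)
    {μ : Fin d} (hμ : μ ≠ ⟨0, h0⟩) {z : Fin d → ℤ} (hz : z ⟨0, h0⟩ = y ⟨0, h0⟩ - 1) : B (z, μ) = 0 := by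
  refine hout z μ (fun h => ?_) (fun h => ?_)
  · have := (mem_box.1 h ⟨0, h0⟩).1
    linarith
  · have := (mem_box.1 h ⟨0, h0⟩).1
    rw [add_unitVec_apply, if_neg hμ.symm, add_zero] at this
    linarith

/-- **THE FACE-WALK IDENTITY** (`d ≥ 2`, directions `e₁ = 0`, `e₂ = 1`).  One step: at any `x`, if the `x_2`-bond above the top face
`⟨x + e₁, x + e₁ + e₂⟩` vanishes, then `B(x, 0) = (∂B)(x; e₁, e₂) + B(x + e₂, 0) + B(x, 1)`. [cite: Balaban1989LargeFieldII, (1.8) p.358] -/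
theorem face_step (h1 : 1 < d) (B : Cfg d) {x : Fin d → ℤ} (hup : B (x + unitVec ⟨0, h0⟩, ⟨1, h1⟩) = 0) :
    B (x, ⟨0, h0⟩) = curl B x ⟨0, h0⟩ ⟨1, h1⟩ + B (x + unitVec ⟨1, h1⟩, ⟨0, h0⟩) + B (x, ⟨1, h1⟩) := by
  simp only [curl, hup]
  ring

/-- The `x₂`-bonds one layer ABOVE the top `x₁`-face are frozen: both ends have `x₁`-coordinate `y₁ + n₁`.
[cite: Balaban1989LargeFieldII, (1.8) p.358] -/
theorem above_eq_zero (h1 : 1 < d) (B : Cfg d)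
    (hout : ∀ (z : Fin d → ℤ) (μ : Fin d), z ∉ box n y → z + unitVec μ ∉ box n y → B (z, μ) = 0)
    {x : Fin d → ℤ} (hx : x ⟨0, h0⟩ = y ⟨0, h0⟩ + n ⟨0, h0⟩ - 1) : B (x + unitVec ⟨0, h0⟩, ⟨1, h1⟩) = 0 := by
  have hne : (⟨0, h0⟩ : Fin d) ≠ ⟨1, h1⟩ := by simp
  refine hout _ _ (fun h => ?_) (fun h => ?_)
  · have := (mem_box.1 h ⟨0, h0⟩).2
    rw [add_unitVec_apply, if_pos rfl] at this
    linarith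
  · have := (mem_box.1 h ⟨0, h0⟩).2
    rw [add_unitVec_apply, if_neg hne, add_zero, add_unitVec_apply, if_pos rfl] at this
    linarith

/-- **THE FACE WALK.**  For `x` on the top `x₁`-face (`x₁ = y₁ + n₁ − 1`): for every `J`,
`B(x, 0) = Σ_{j<J} [(∂B)(x + je₂; e₁, e₂) + B(x + je₂, 1)] + B(x + Je₂, 0)`. [cite: Balaban1989LargeFieldII, (1.8) p.358] -/
theorem face_eq_sum (h1 : 1 < d) (B : Cfg d)
    (hout : ∀ (z : Fin d → ℤ) (μ : Fin d), z ∉ box n y → z + unitVec μ ∉ box n y → B (z, μ) = 0)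
    {x : Fin d → ℤ} (hx : x ⟨0, h0⟩ = y ⟨0, h0⟩ + n ⟨0, h0⟩ - 1) (J : ℕ) :
    B (x, ⟨0, h0⟩) =
      ∑ j ∈ range J, (curl B (x + (j : ℤ) • unitVec ⟨1, h1⟩) ⟨0, h0⟩ ⟨1, h1⟩ +
          B (x + (j : ℤ) • unitVec ⟨1, h1⟩, ⟨1, h1⟩)) +
        B (x + (J : ℤ) • unitVec ⟨1, h1⟩, ⟨0, h0⟩) := by
  have hne : (⟨1, h1⟩ : Fin d) ≠ ⟨0, h0⟩ := by simp
  induction J with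
  | zero => simp
  | succ J ih =>
    have hxJ : (x + (J : ℤ) • unitVec ⟨1, h1⟩) ⟨0, h0⟩ = y ⟨0, h0⟩ + n ⟨0, h0⟩ - 1 := by
      rw [add_zsmul_unitVec_apply, if_neg hne.symm, add_zero, hx]
    have hstep := face_step h0 h1 B (above_eq_zero h0 h1 B hout hxJ)
    have hpt : x + ((J + 1 : ℕ) : ℤ) • unitVec ⟨1, h1⟩ = x + (J : ℤ) • unitVec ⟨1, h1⟩ + unitVec ⟨1, h1⟩ := by
      rw [Nat.cast_succ, add_smul, one_smul, add_assoc]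
    rw [ih, sum_range_succ, hstep, hpt]
    ring

/-- The face walk ends on a frozen variable: after `J = y₂ + n₂ − x₂` steps the `x₁`-bond `⟨x + Je₂, x + Je₂ + e₁⟩` has both ends off
`Λ`. [cite: Balaban1989LargeFieldII, (1.8) p.358] -/
theorem faceEnd_eq_zero (h1 : 1 < d) (B : Cfg d)
    (hout : ∀ (z : Fin d → ℤ) (μ : Fin d), z ∉ box n y → z + unitVec μ ∉ box n y → B (z, μ) = 0)
    {x : Fin d → ℤ} {J : ℕ} (hJ : x ⟨1, h1⟩ + J = y ⟨1, h1⟩ + n ⟨1, h1⟩) :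
    B (x + (J : ℤ) • unitVec ⟨1, h1⟩, ⟨0, h0⟩) = 0 := by
  have hne : (⟨1, h1⟩ : Fin d) ≠ ⟨0, h0⟩ := by simp
  refine hout _ _ (fun h => ?_) (fun h => ?_)
  · have := (mem_box.1 h ⟨1, h1⟩).2
    rw [add_zsmul_unitVec_apply, if_pos rfl] at this
    linarith
  · have := (mem_box.1 h ⟨1, h1⟩).2
    rw [add_unitVec_apply, if_neg hne, add_zero, add_zsmul_unitVec_apply, if_pos rfl] at this
    linarith

end Identities

/-! ## §2 Pointwise bounds and the sup-form of the `x₁`-axial (1.8) -/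

section SupForm

variable (h0 : 0 < d)

/-- **Ladder bound.**  For `μ ≠ 0` and a bond `⟨w, w + e_μ⟩` whose `x₁`-coordinate lies in the box range, `|B(w, μ)| ≤ K·S` where `S`
bounds `|∂B|` and `n₁ ≤ K`. [cite: Balaban1989LargeFieldII, (1.8) p.358] -/
theorem abs_ladder_le (B : Cfg d) (hax : ∀ x ∈ box n y, B (x - unitVec ⟨0, h0⟩, ⟨0, h0⟩) = 0)
    (hout : ∀ (z : Fin d → ℤ) (μ : Fin d), z ∉ box n y → z + unitVec μ ∉ box n y → B (z, μ) = 0)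
    {S : ℝ} (hS : ∀ z μ, |curl B z ⟨0, h0⟩ μ| ≤ S) {K : ℕ} (hK : n ⟨0, h0⟩ ≤ K)
    {μ : Fin d} (hμ : μ ≠ ⟨0, h0⟩) {w : Fin d → ℤ} (hw1 : y ⟨0, h0⟩ ≤ w ⟨0, h0⟩)
    (hw2 : w ⟨0, h0⟩ < y ⟨0, h0⟩ + n ⟨0, h0⟩) : |B (w, μ)| ≤ K * S := by
  -- base point `z` below the box and the number of rungs `m`
  set m : ℕ := (w ⟨0, h0⟩ - y ⟨0, h0⟩ + 1).toNat with hm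
  have hmz : (m : ℤ) = w ⟨0, h0⟩ - y ⟨0, h0⟩ + 1 := by rw [hm, Int.toNat_of_nonneg (by linarith)]
  have hmle : m ≤ n ⟨0, h0⟩ := by
    have : (m : ℤ) ≤ n ⟨0, h0⟩ := by rw [hmz]; linarith
    exact_mod_cast this
  set z : Fin d → ℤ := w + (-(m : ℤ)) • unitVec ⟨0, h0⟩ with hzdef
  have hz : z ⟨0, h0⟩ = y ⟨0, h0⟩ - 1 := by
    rw [hzdef, add_zsmul_unitVec_apply, if_pos rfl, hmz]
    ring
  have hw : w = z + (m : ℤ) • unitVec ⟨0, h0⟩ := by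
    rw [hzdef, add_assoc, ← add_smul, neg_add_cancel, zero_smul, add_zero]
  have hS0 : 0 ≤ S := (abs_nonneg _).trans (hS w μ)
  rw [hw, ladder_eq_sum h0 B hax hout hμ hz m hmle, base_eq_zero h0 B hout hμ hz, zero_add]
  calc |∑ s ∈ range m, curl B (z + (s : ℤ) • unitVec ⟨0, h0⟩) ⟨0, h0⟩ μ|
      ≤ ∑ s ∈ range m, |curl B (z + (s : ℤ) • unitVec ⟨0, h0⟩) ⟨0, h0⟩ μ| := abs_sum_le_sum_abs _ _
    _ ≤ ∑ _s ∈ range m, S := sum_le_sum fun s _ => hS _ _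
    _ = m * S := by rw [sum_const, card_range, nsmul_eq_mul]
    _ ≤ K * S := mul_le_mul_of_nonneg_right (by exact_mod_cast hmle.trans hK) hS0

/-- Bonds `⟨w, w + e_μ⟩`, `μ ≠ 0`, with `x₁`-coordinate OUT of the box range are frozen. [cite: Balaban1989LargeFieldII, (1.8) p.358] -/
theorem eq_zero_of_out (B : Cfg d)
    (hout : ∀ (z : Fin d → ℤ) (μ : Fin d), z ∉ box n y → z + unitVec μ ∉ box n y → B (z, μ) = 0)
    {μ : Fin d} (hμ : μ ≠ ⟨0, h0⟩) {w : Fin d → ℤ}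
    (hw : ¬ (y ⟨0, h0⟩ ≤ w ⟨0, h0⟩ ∧ w ⟨0, h0⟩ < y ⟨0, h0⟩ + n ⟨0, h0⟩)) : B (w, μ) = 0 := by
  refine hout w μ (fun h => hw (mem_box.1 h ⟨0, h0⟩)) (fun h => hw ?_)
  have := mem_box.1 h ⟨0, h0⟩
  rwa [add_unitVec_apply, if_neg hμ.symm, add_zero] at this

/-- Hence for `μ ≠ 0` and EVERY `w`: `|B(w, μ)| ≤ K·S`. [cite: Balaban1989LargeFieldII, (1.8) p.358] -/
theorem abs_le_of_ne (B : Cfg d) (hax : ∀ x ∈ box n y, B (x - unitVec ⟨0, h0⟩, ⟨0, h0⟩) = 0)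
    (hout : ∀ (z : Fin d → ℤ) (μ : Fin d), z ∉ box n y → z + unitVec μ ∉ box n y → B (z, μ) = 0)
    {S : ℝ} (hS : ∀ z μ, |curl B z ⟨0, h0⟩ μ| ≤ S) {K : ℕ} (hK : n ⟨0, h0⟩ ≤ K)
    {μ : Fin d} (hμ : μ ≠ ⟨0, h0⟩) (w : Fin d → ℤ) : |B (w, μ)| ≤ K * S := by
  have hS0 : 0 ≤ S := (abs_nonneg _).trans (hS w μ)
  by_cases hw : y ⟨0, h0⟩ ≤ w ⟨0, h0⟩ ∧ w ⟨0, h0⟩ < y ⟨0, h0⟩ + n ⟨0, h0⟩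
  · exact abs_ladder_le h0 B hax hout hS hK hμ hw.1 hw.2
  · rw [eq_zero_of_out h0 B hout hμ hw, abs_zero]
    positivity

/-- **Face bound.**  For `x` on the top `x₁`-face inside the `x₂`-range of the box, `|B(x, 0)| ≤ (K + K²)·S` (`n₁, n₂ ≤ K`; `d ≥ 2`).
[cite: Balaban1989LargeFieldII, (1.8) p.358] -/
theorem abs_face_le (h1 : 1 < d) (B : Cfg d) (hax : ∀ x ∈ box n y, B (x - unitVec ⟨0, h0⟩, ⟨0, h0⟩) = 0)
    (hout : ∀ (z : Fin d → ℤ) (μ : Fin d), z ∉ box n y → z + unitVec μ ∉ box n y → B (z, μ) = 0)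
    {S : ℝ} (hS : ∀ z μ, |curl B z ⟨0, h0⟩ μ| ≤ S) {K : ℕ} (hK0 : n ⟨0, h0⟩ ≤ K) (hK1 : n ⟨1, h1⟩ ≤ K)
    {x : Fin d → ℤ} (hx : x ⟨0, h0⟩ = y ⟨0, h0⟩ + n ⟨0, h0⟩ - 1) (hx1 : y ⟨1, h1⟩ ≤ x ⟨1, h1⟩)
    (hx2 : x ⟨1, h1⟩ ≤ y ⟨1, h1⟩ + n ⟨1, h1⟩) : |B (x, ⟨0, h0⟩)| ≤ (K + K ^ 2) * S := by
  have hne : (⟨1, h1⟩ : Fin d) ≠ ⟨0, h0⟩ := by simp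
  have hS0 : 0 ≤ S := (abs_nonneg _).trans (hS x ⟨1, h1⟩)
  set J : ℕ := (y ⟨1, h1⟩ + n ⟨1, h1⟩ - x ⟨1, h1⟩).toNat with hJdef
  have hJz : (J : ℤ) = y ⟨1, h1⟩ + n ⟨1, h1⟩ - x ⟨1, h1⟩ := by rw [hJdef, Int.toNat_of_nonneg (by linarith)]
  have hJle : J ≤ K := by
    have : (J : ℤ) ≤ n ⟨1, h1⟩ := by rw [hJz]; linarith
    exact_mod_cast (show J ≤ n ⟨1, h1⟩ by exact_mod_cast this).trans hK1
  have hJ : x ⟨1, h1⟩ + J = y ⟨1, h1⟩ + n ⟨1, h1⟩ := by rw [hJz]; ring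
  rw [face_eq_sum h0 h1 B hout hx J, faceEnd_eq_zero h0 h1 B hout hJ, add_zero]
  calc |∑ j ∈ range J, (curl B (x + (j : ℤ) • unitVec ⟨1, h1⟩) ⟨0, h0⟩ ⟨1, h1⟩ + B (x + (j : ℤ) • unitVec ⟨1, h1⟩, ⟨1, h1⟩))|
      ≤ ∑ j ∈ range J, |curl B (x + (j : ℤ) • unitVec ⟨1, h1⟩) ⟨0, h0⟩ ⟨1, h1⟩ + B (x + (j : ℤ) • unitVec ⟨1, h1⟩, ⟨1, h1⟩)| :=
        abs_sum_le_sum_abs _ _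
    _ ≤ ∑ _j ∈ range J, (S + K * S) := sum_le_sum fun j _ =>
        (abs_add_le _ _).trans (add_le_add (hS _ _) (abs_le_of_ne h0 B hax hout hS hK0 hne _))
    _ = J * (S + K * S) := by rw [sum_const, card_range, nsmul_eq_mul]
    _ ≤ K * (S + K * S) := mul_le_mul_of_nonneg_right (by exact_mod_cast hJle) (by positivity)
    _ = (K + K ^ 2) * S := by ring

/-- `x₁`-bonds on the top face but OUTSIDE the `x₂`-range of the box are frozen (both ends off `Λ`). [cite: Balaban1989LargeFieldII, (1.8) p.358] -/
theorem dir0_eq_zero_of_out1 (h1 : 1 < d) (B : Cfg d)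
    (hout : ∀ (z : Fin d → ℤ) (μ : Fin d), z ∉ box n y → z + unitVec μ ∉ box n y → B (z, μ) = 0)
    {x : Fin d → ℤ} (hx1 : ¬ (y ⟨1, h1⟩ ≤ x ⟨1, h1⟩ ∧ x ⟨1, h1⟩ ≤ y ⟨1, h1⟩ + n ⟨1, h1⟩)) : B (x, ⟨0, h0⟩) = 0 := by
  have hne : (⟨1, h1⟩ : Fin d) ≠ ⟨0, h0⟩ := by simp
  refine hout x _ (fun h => hx1 ?_) (fun h => hx1 ?_)
  · have := mem_box.1 h ⟨1, h1⟩
    exact ⟨this.1, by linarith [this.2]⟩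
  · have := mem_box.1 h ⟨1, h1⟩
    rw [add_unitVec_apply, if_neg hne, add_zero] at this
    exact ⟨this.1, by linarith [this.2]⟩

/-- **THE SUP-FORM OF THE `x₁`-AXIAL (1.8).**  For a box `Λ` with sides `n₁, n₂ ≤ K` (`d ≥ 2`), a real bond field `B` supported on
the bonds meeting `Λ` and in the `x₁`-axial gauge, and any bound `S` of `|(∂B)(p)|` over the `(x₁, x_μ)`-plaquettes:
`|B(b)| ≤ (K² + 2K)·S` for EVERY bond `b` — *«if in this domain Λ we fix an axial gauge in the direction of x₁-axis … the inequality
(1.8) holds»* in the sup norm (the `ℓ²` form with its constant is the located remainder, §3 and HONEST SCOPE (i)).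
[cite: Balaban1989LargeFieldII, (1.8) p.358] -/
theorem abs_le_axial (h1 : 1 < d) (B : Cfg d) (hax : ∀ x ∈ box n y, B (x - unitVec ⟨0, h0⟩, ⟨0, h0⟩) = 0)
    (hout : ∀ (z : Fin d → ℤ) (μ : Fin d), z ∉ box n y → z + unitVec μ ∉ box n y → B (z, μ) = 0)
    {S : ℝ} (hS : ∀ z μ, |curl B z ⟨0, h0⟩ μ| ≤ S) {K : ℕ} (hK0 : n ⟨0, h0⟩ ≤ K) (hK1 : n ⟨1, h1⟩ ≤ K)
    (b : (Fin d → ℤ) × Fin d) : |B b| ≤ ((K : ℝ) ^ 2 + 2 * K) * S := by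
  obtain ⟨w, μ⟩ := b
  have hS0 : 0 ≤ S := (abs_nonneg _).trans (hS w μ)
  have hK : (0 : ℝ) ≤ K := Nat.cast_nonneg K
  by_cases hμ : μ = ⟨0, h0⟩
  · subst hμ
    by_cases htop : w ∈ box n y ∧ w + unitVec ⟨0, h0⟩ ∉ box n y
    · -- an `x₁`-bond exiting the top face
      have hwb := mem_box.1 htop.1
      have hx : w ⟨0, h0⟩ = y ⟨0, h0⟩ + n ⟨0, h0⟩ - 1 := by
        have hle := (hwb ⟨0, h0⟩).2
        by_contra hne
        apply htop.2
        rw [mem_box]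
        intro i
        rw [add_unitVec_apply]
        by_cases hi : i = ⟨0, h0⟩
        · subst hi
          simp only [if_true]
          exact ⟨by linarith [(hwb ⟨0, h0⟩).1], by omega⟩
        · simp only [hi, if_false, add_zero]
          exact hwb i
      have h1r := hwb ⟨1, h1⟩
      calc |B (w, ⟨0, h0⟩)| ≤ (K + K ^ 2) * S :=
            abs_face_le h0 h1 B hax hout hS hK0 hK1 hx h1r.1 (by linarith [h1r.2])
        _ ≤ ((K : ℝ) ^ 2 + 2 * K) * S := by nlinarith
    · rw [dir0_eq_zero h0 B hax hout htop, abs_zero]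
      positivity
  · calc |B (w, μ)| ≤ K * S := abs_le_of_ne h0 B hax hout hS hK0 hμ w
      _ ≤ ((K : ℝ) ^ 2 + 2 * K) * S := by nlinarith

end SupForm

/-! ## §3 Squared pointwise bounds (the mechanism of the printed `ℓ²` form) -/

section Squares

variable (h0 : 0 < d)

/-- **Squared ladder bound** (Cauchy–Schwarz on the ladder identity): for `μ ≠ 0` and the base point `z` below the box,
`B(z + m•e₁, μ)² ≤ m · Σ_{s<m} (∂B)(z + s•e₁; e₁, e_μ)²` (`m ≤ n₁`). [cite: Balaban1989LargeFieldII, (1.8) p.358] -/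
theorem sq_ladder_le (B : Cfg d) (hax : ∀ x ∈ box n y, B (x - unitVec ⟨0, h0⟩, ⟨0, h0⟩) = 0)
    (hout : ∀ (z : Fin d → ℤ) (μ : Fin d), z ∉ box n y → z + unitVec μ ∉ box n y → B (z, μ) = 0)
    {μ : Fin d} (hμ : μ ≠ ⟨0, h0⟩) {z : Fin d → ℤ} (hz : z ⟨0, h0⟩ = y ⟨0, h0⟩ - 1) {m : ℕ} (hm : m ≤ n ⟨0, h0⟩) :
    B (z + (m : ℤ) • unitVec ⟨0, h0⟩, μ) ^ 2 ≤
      m * ∑ s ∈ range m, curl B (z + (s : ℤ) • unitVec ⟨0, h0⟩) ⟨0, h0⟩ μ ^ 2 := by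
  rw [ladder_eq_sum h0 B hax hout hμ hz m hm, base_eq_zero h0 B hout hμ hz, zero_add]
  have h := sq_sum_le_card_mul_sum_sq (s := range m) (f := fun s => curl B (z + (s : ℤ) • unitVec ⟨0, h0⟩) ⟨0, h0⟩ μ)
  rw [card_range] at h
  exact h

/-- **Squared face bound** (Cauchy–Schwarz on the face walk): for `x` on the top face and `J` with `x₂ + J = y₂ + n₂`,
`B(x, 0)² ≤ 2J·Σ_{j<J} (∂B)(x + je₂; e₁, e₂)² + 2J·Σ_{j<J} B(x + je₂, 1)²`. [cite: Balaban1989LargeFieldII, (1.8) p.358] -/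
theorem sq_face_le (h1 : 1 < d) (B : Cfg d)
    (hout : ∀ (z : Fin d → ℤ) (μ : Fin d), z ∉ box n y → z + unitVec μ ∉ box n y → B (z, μ) = 0)
    {x : Fin d → ℤ} (hx : x ⟨0, h0⟩ = y ⟨0, h0⟩ + n ⟨0, h0⟩ - 1) {J : ℕ} (hJ : x ⟨1, h1⟩ + J = y ⟨1, h1⟩ + n ⟨1, h1⟩) :
    B (x, ⟨0, h0⟩) ^ 2 ≤
      2 * J * ∑ j ∈ range J, curl B (x + (j : ℤ) • unitVec ⟨1, h1⟩) ⟨0, h0⟩ ⟨1, h1⟩ ^ 2 +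
        2 * J * ∑ j ∈ range J, B (x + (j : ℤ) • unitVec ⟨1, h1⟩, ⟨1, h1⟩) ^ 2 := by
  rw [face_eq_sum h0 h1 B hout hx J, faceEnd_eq_zero h0 h1 B hout hJ, add_zero, sum_add_distrib]
  set a := ∑ j ∈ range J, curl B (x + (j : ℤ) • unitVec ⟨1, h1⟩) ⟨0, h0⟩ ⟨1, h1⟩ with ha
  set c := ∑ j ∈ range J, B (x + (j : ℤ) • unitVec ⟨1, h1⟩, ⟨1, h1⟩) with hc
  have ha2 : a ^ 2 ≤ J * ∑ j ∈ range J, curl B (x + (j : ℤ) • unitVec ⟨1, h1⟩) ⟨0, h0⟩ ⟨1, h1⟩ ^ 2 := by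
    have h := sq_sum_le_card_mul_sum_sq (s := range J)
      (f := fun j => curl B (x + (j : ℤ) • unitVec ⟨1, h1⟩) ⟨0, h0⟩ ⟨1, h1⟩)
    rw [card_range] at h
    exact h
  have hc2 : c ^ 2 ≤ J * ∑ j ∈ range J, B (x + (j : ℤ) • unitVec ⟨1, h1⟩, ⟨1, h1⟩) ^ 2 := by
    have h := sq_sum_le_card_mul_sum_sq (s := range J) (f := fun j => B (x + (j : ℤ) • unitVec ⟨1, h1⟩, ⟨1, h1⟩))
    rw [card_range] at h
    exact h
  have hsq : (a + c) ^ 2 ≤ 2 * a ^ 2 + 2 * c ^ 2 := by nlinarith [sq_nonneg (a - c)]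
  linarith

end Squares

/-! ## §4 THE `ℓ²` FORM: summation over the box -/

section L2

variable (h0 : 0 < d)

/-- Translation sums are dominated by the sum over any set carrying the support (nonnegative summand). [folklore] -/
private theorem sum_shift_le {E H : Finset (Fin d → ℤ)} (f : (Fin d → ℤ) → ℝ) (hf : ∀ w, 0 ≤ f w)
    (hsupp : ∀ w, f w ≠ 0 → w ∈ H) (v : Fin d → ℤ) : ∑ z ∈ E, f (z + v) ≤ ∑ w ∈ H, f w := by
  classical
  have hinj : Function.Injective fun z : Fin d → ℤ => z + v := fun a b h => add_right_cancel h
  rw [← Finset.sum_image (f := f) (fun a _ b _ h => hinj h)]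
  set M := E.image fun z => z + v with hM
  rw [← sum_filter_add_sum_filter_not M (fun w => w ∈ H) f]
  have h2 : ∑ w ∈ M with ¬ w ∈ H, f w = 0 :=
    sum_eq_zero fun w hw => by
      have hw' := (mem_filter.1 hw).2
      by_contra hne
      exact hw' (hsupp w hne)
  rw [h2, add_zero]
  exact sum_le_sum_of_subset_of_nonneg (fun w hw => (mem_filter.1 hw).2) fun w _ _ => hf w

/-- The VARIABLES live on the bonds issuing from the box enlarged by one layer: `B(z, μ) ≠ 0 ⇒ z ∈ box (n+2) (y−1)`.
[cite: Balaban1989LargeFieldII, (1.8) p.358] -/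
theorem mem_bigBox_of_ne (B : Cfg d)
    (hout : ∀ (z : Fin d → ℤ) (μ : Fin d), z ∉ box n y → z + unitVec μ ∉ box n y → B (z, μ) = 0)
    {z : Fin d → ℤ} {μ : Fin d} (hB : B (z, μ) ≠ 0) : z ∈ box (fun i => n i + 2) (fun i => y i - 1) := by
  rw [mem_box]
  by_cases h1 : z ∈ box n y
  · intro i
    have := mem_box.1 h1 i
    push_cast; constructor <;> linarith
  · by_cases h2 : z + unitVec μ ∈ box n y
    · intro i
      have := mem_box.1 h2 i
      rw [add_unitVec_apply] at this
      push_cast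
      split_ifs at this <;> constructor <;> linarith
    · exact absurd (hout z μ h1 h2) hB

/-- The plaquette variables live on the box enlarged by two layers: `(∂B)(z; e₁, e_μ) ≠ 0 ⇒ z ∈ box (n+3) (y−2)`.
[cite: Balaban1989LargeFieldII, (1.8) p.358] -/
theorem mem_plaqBox_of_ne (B : Cfg d)
    (hout : ∀ (z : Fin d → ℤ) (μ : Fin d), z ∉ box n y → z + unitVec μ ∉ box n y → B (z, μ) = 0)
    {z : Fin d → ℤ} {μ : Fin d} (hc : curl B z ⟨0, h0⟩ μ ≠ 0) : z ∈ box (fun i => n i + 3) (fun i => y i - 2) := by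
  -- one of the four bond variables is non-zero; its initial point is `z`, `z + e₁` or `z + e_μ`
  have key : ∀ {w : Fin d → ℤ} {κ ν : Fin d}, B (w, ν) ≠ 0 → (w = z ∨ w = z + unitVec κ) →
      z ∈ box (fun i => n i + 3) (fun i => y i - 2) := by
    intro w κ ν hB hw
    have hmem := mem_box.1 (mem_bigBox_of_ne B hout hB)
    rw [mem_box]
    intro i
    have := hmem i
    push_cast at this ⊢
    rcases hw with rfl | rfl
    · constructor <;> linarith
    · rw [add_unitVec_apply] at this
      split_ifs at this <;> constructor <;> linarith
  by_contra hz
  apply hc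
  have h1 : B (z, ⟨0, h0⟩) = 0 := by
    by_contra h; exact hz (key (κ := μ) h (Or.inl rfl))
  have h2 : B (z + unitVec ⟨0, h0⟩, μ) = 0 := by
    by_contra h; exact hz (key h (Or.inr rfl))
  have h3 : B (z + unitVec μ, ⟨0, h0⟩) = 0 := by
    by_contra h; exact hz (key h (Or.inr rfl))
  have h4 : B (z, μ) = 0 := by
    by_contra h; exact hz (key (κ := μ) h (Or.inl rfl))
  simp [curl, h1, h2, h3, h4]

/-- **Squared ladder bound, uniform form**: for `μ ≠ 0` and EVERY `z`, `B(z, μ)² ≤ K·Σ_{t<K} (∂B)(z − (t+1)e₁; e₁, e_μ)²`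
(`n₁ ≤ K`). [cite: Balaban1989LargeFieldII, (1.8) p.358] -/
theorem sq_le_uniform_of_ne (B : Cfg d) (hax : ∀ x ∈ box n y, B (x - unitVec ⟨0, h0⟩, ⟨0, h0⟩) = 0)
    (hout : ∀ (z : Fin d → ℤ) (μ : Fin d), z ∉ box n y → z + unitVec μ ∉ box n y → B (z, μ) = 0)
    {K : ℕ} (hK : n ⟨0, h0⟩ ≤ K) {μ : Fin d} (hμ : μ ≠ ⟨0, h0⟩) (w : Fin d → ℤ) :
    B (w, μ) ^ 2 ≤ K * ∑ t ∈ range K, curl B (w + (-((t : ℤ) + 1)) • unitVec ⟨0, h0⟩) ⟨0, h0⟩ μ ^ 2 := by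
  have hnn : 0 ≤ (K : ℝ) * ∑ t ∈ range K, curl B (w + (-((t : ℤ) + 1)) • unitVec ⟨0, h0⟩) ⟨0, h0⟩ μ ^ 2 :=
    mul_nonneg (Nat.cast_nonneg K) (sum_nonneg fun _ _ => sq_nonneg _)
  by_cases hw : y ⟨0, h0⟩ ≤ w ⟨0, h0⟩ ∧ w ⟨0, h0⟩ < y ⟨0, h0⟩ + n ⟨0, h0⟩
  · set m : ℕ := (w ⟨0, h0⟩ - y ⟨0, h0⟩ + 1).toNat with hm
    have hmz : (m : ℤ) = w ⟨0, h0⟩ - y ⟨0, h0⟩ + 1 := by rw [hm, Int.toNat_of_nonneg (by linarith [hw.1])]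
    have hmle : m ≤ n ⟨0, h0⟩ := by
      have : (m : ℤ) ≤ n ⟨0, h0⟩ := by rw [hmz]; linarith [hw.2]
      exact_mod_cast this
    set z : Fin d → ℤ := w + (-(m : ℤ)) • unitVec ⟨0, h0⟩ with hzdef
    have hz : z ⟨0, h0⟩ = y ⟨0, h0⟩ - 1 := by
      rw [hzdef, add_zsmul_unitVec_apply, if_pos rfl, hmz]
      ring
    have hwz : w = z + (m : ℤ) • unitVec ⟨0, h0⟩ := by
      rw [hzdef, add_assoc, ← add_smul, neg_add_cancel, zero_smul, add_zero]
    have h1 := sq_ladder_le h0 B hax hout hμ hz hmle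
    rw [← hwz] at h1
    -- reflect the ladder sum: `z + s•e₁ = w − (m − s)•e₁ = w − (t+1)•e₁`, `t = m − 1 − s`
    have hrefl : ∑ s ∈ range m, curl B (z + (s : ℤ) • unitVec ⟨0, h0⟩) ⟨0, h0⟩ μ ^ 2 =
        ∑ t ∈ range m, curl B (w + (-((t : ℤ) + 1)) • unitVec ⟨0, h0⟩) ⟨0, h0⟩ μ ^ 2 := by
      rw [← sum_range_reflect (fun t => curl B (w + (-((t : ℤ) + 1)) • unitVec ⟨0, h0⟩) ⟨0, h0⟩ μ ^ 2) m]
      refine sum_congr rfl fun s hs => ?_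
      have hs' : s < m := mem_range.1 hs
      congr 2
      rw [hwz, add_assoc, ← add_smul]
      congr 2
      push_cast [Nat.sub_sub, Nat.cast_sub (by omega : 1 + s ≤ m)]
      ring
    rw [hrefl] at h1
    calc B (w, μ) ^ 2 ≤ m * ∑ t ∈ range m, curl B (w + (-((t : ℤ) + 1)) • unitVec ⟨0, h0⟩) ⟨0, h0⟩ μ ^ 2 := h1
      _ ≤ K * ∑ t ∈ range K, curl B (w + (-((t : ℤ) + 1)) • unitVec ⟨0, h0⟩) ⟨0, h0⟩ μ ^ 2 := by
          have hmK : m ≤ K := hmle.trans hK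
          exact mul_le_mul (by exact_mod_cast hmK)
            (sum_le_sum_of_subset_of_nonneg (range_mono hmK) fun _ _ _ => sq_nonneg _)
            (sum_nonneg fun _ _ => sq_nonneg _) (Nat.cast_nonneg K)
  · rw [eq_zero_of_out h0 B hout hμ hw]
    simpa using hnn

/-- **Squared face bound, uniform form**: for EVERY `x`, `B(x, 0)² ≤ 2K·Σ_{j<K} (∂B)(x + je₂; e₁, e₂)² + 2K·Σ_{j<K} B(x + je₂, 1)²`
(`n₂ ≤ K`, `d ≥ 2`). [cite: Balaban1989LargeFieldII, (1.8) p.358] -/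
theorem sq_dir0_le_uniform (h1 : 1 < d) (B : Cfg d) (hax : ∀ x ∈ box n y, B (x - unitVec ⟨0, h0⟩, ⟨0, h0⟩) = 0)
    (hout : ∀ (z : Fin d → ℤ) (μ : Fin d), z ∉ box n y → z + unitVec μ ∉ box n y → B (z, μ) = 0)
    {K : ℕ} (hK1 : n ⟨1, h1⟩ ≤ K) (x : Fin d → ℤ) :
    B (x, ⟨0, h0⟩) ^ 2 ≤
      2 * K * ∑ j ∈ range K, curl B (x + (j : ℤ) • unitVec ⟨1, h1⟩) ⟨0, h0⟩ ⟨1, h1⟩ ^ 2 +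
        2 * K * ∑ j ∈ range K, B (x + (j : ℤ) • unitVec ⟨1, h1⟩, ⟨1, h1⟩) ^ 2 := by
  have hnn : 0 ≤ 2 * (K : ℝ) * ∑ j ∈ range K, curl B (x + (j : ℤ) • unitVec ⟨1, h1⟩) ⟨0, h0⟩ ⟨1, h1⟩ ^ 2 +
      2 * K * ∑ j ∈ range K, B (x + (j : ℤ) • unitVec ⟨1, h1⟩, ⟨1, h1⟩) ^ 2 := by positivity
  by_cases htop : x ∈ box n y ∧ x + unitVec ⟨0, h0⟩ ∉ box n y
  · have hxb := mem_box.1 htop.1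
    have hx : x ⟨0, h0⟩ = y ⟨0, h0⟩ + n ⟨0, h0⟩ - 1 := by
      by_contra hne
      apply htop.2
      rw [mem_box]
      intro i
      rw [add_unitVec_apply]
      by_cases hi : i = ⟨0, h0⟩
      · subst hi
        simp only [if_true]
        exact ⟨by linarith [(hxb ⟨0, h0⟩).1], by have := (hxb ⟨0, h0⟩).2; omega⟩
      · simp only [hi, if_false, add_zero]
        exact hxb i
    set J : ℕ := (y ⟨1, h1⟩ + n ⟨1, h1⟩ - x ⟨1, h1⟩).toNat with hJdef
    have hJz : (J : ℤ) = y ⟨1, h1⟩ + n ⟨1, h1⟩ - x ⟨1, h1⟩ := by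
      rw [hJdef, Int.toNat_of_nonneg (by linarith [(hxb ⟨1, h1⟩).2])]
    have hJK : J ≤ K := by
      have : (J : ℤ) ≤ n ⟨1, h1⟩ := by rw [hJz]; linarith [(hxb ⟨1, h1⟩).1]
      exact (show J ≤ n ⟨1, h1⟩ by exact_mod_cast this).trans hK1
    have hJ : x ⟨1, h1⟩ + J = y ⟨1, h1⟩ + n ⟨1, h1⟩ := by rw [hJz]; ring
    have h := sq_face_le h0 h1 B hout hx hJ
    have hJK' : (J : ℝ) ≤ K := by exact_mod_cast hJK
    have hs1 : ∑ j ∈ range J, curl B (x + (j : ℤ) • unitVec ⟨1, h1⟩) ⟨0, h0⟩ ⟨1, h1⟩ ^ 2 ≤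
        ∑ j ∈ range K, curl B (x + (j : ℤ) • unitVec ⟨1, h1⟩) ⟨0, h0⟩ ⟨1, h1⟩ ^ 2 :=
      sum_le_sum_of_subset_of_nonneg (range_mono hJK) fun _ _ _ => sq_nonneg _
    have hs2 : ∑ j ∈ range J, B (x + (j : ℤ) • unitVec ⟨1, h1⟩, ⟨1, h1⟩) ^ 2 ≤
        ∑ j ∈ range K, B (x + (j : ℤ) • unitVec ⟨1, h1⟩, ⟨1, h1⟩) ^ 2 :=
      sum_le_sum_of_subset_of_nonneg (range_mono hJK) fun _ _ _ => sq_nonneg _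
    have hA : 0 ≤ ∑ j ∈ range K, curl B (x + (j : ℤ) • unitVec ⟨1, h1⟩) ⟨0, h0⟩ ⟨1, h1⟩ ^ 2 :=
      sum_nonneg fun _ _ => sq_nonneg _
    have hB' : 0 ≤ ∑ j ∈ range K, B (x + (j : ℤ) • unitVec ⟨1, h1⟩, ⟨1, h1⟩) ^ 2 := sum_nonneg fun _ _ => sq_nonneg _
    nlinarith
  · rw [dir0_eq_zero h0 B hax hout htop]
    simpa using hnn

/-- **THE `x₁`-AXIAL (1.8) IN `ℓ²`** ([LF-II] p. 358: *«if in this domain Λ we fix an axial gauge in the direction of x₁-axis … then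
the inequality (1.8) holds»*; cell GAPS G-r2.9).  For a box `Λ = box n y` with `n₁, n₂ ≤ K` (`d ≥ 2`) and a real bond field `B`
supported on the bonds meeting `Λ` in the `x₁`-axial gauge:
`Σ_{z ∈ box (n+2) (y−1)} Σ_μ B(z, μ)² ≤ (3K² + 2K⁴) · Σ_{z ∈ box (n+3) (y−2)} Σ_μ (∂B)(z; e₁, e_μ)²`.
The left sum contains every bond carrying a variable (`mem_bigBox_of_ne`), the right sum every plaquette in an `(x₁, x_μ)`-plane
with a non-zero variable (`mem_plaqBox_of_ne`).  Constant by this route `O(K⁴)`; print: `(100M)³` (p. 358 *«with different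
constants»*; for (1.9) any `≤ d(100M)^{d+1}` serves). [cite: Balaban1989LargeFieldII, (1.8) p.358] -/
theorem ineq18_axial (h1 : 1 < d) (B : Cfg d) (hax : ∀ x ∈ box n y, B (x - unitVec ⟨0, h0⟩, ⟨0, h0⟩) = 0)
    (hout : ∀ (z : Fin d → ℤ) (μ : Fin d), z ∉ box n y → z + unitVec μ ∉ box n y → B (z, μ) = 0)
    {K : ℕ} (hK0 : n ⟨0, h0⟩ ≤ K) (hK1 : n ⟨1, h1⟩ ≤ K) :
    ∑ z ∈ box (fun i => n i + 2) (fun i => y i - 1), ∑ μ : Fin d, B (z, μ) ^ 2 ≤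
      (3 * (K : ℝ) ^ 2 + 2 * (K : ℝ) ^ 4) *
        ∑ z ∈ box (fun i => n i + 3) (fun i => y i - 2), ∑ μ : Fin d, curl B z ⟨0, h0⟩ μ ^ 2 := by
  set E := box (fun i => n i + 2) (fun i => y i - 1) with hE
  set H := box (fun i => n i + 3) (fun i => y i - 2) with hH
  set R : Fin d → ℝ := fun μ => ∑ z ∈ H, curl B z ⟨0, h0⟩ μ ^ 2 with hR
  have hRnn : ∀ μ, 0 ≤ R μ := fun μ => sum_nonneg fun _ _ => sq_nonneg _
  have hRsum : ∑ z ∈ H, ∑ μ : Fin d, curl B z ⟨0, h0⟩ μ ^ 2 = ∑ μ : Fin d, R μ := sum_comm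
  have hK : (0 : ℝ) ≤ K := Nat.cast_nonneg K
  -- (a) the directions `μ ≠ 0`: per `μ`, `Σ_{z∈E} B(z,μ)² ≤ K²·R μ`
  have ha : ∀ μ : Fin d, μ ≠ ⟨0, h0⟩ → ∑ z ∈ E, B (z, μ) ^ 2 ≤ (K : ℝ) ^ 2 * R μ := by
    intro μ hμ
    calc ∑ z ∈ E, B (z, μ) ^ 2
        ≤ ∑ z ∈ E, (K : ℝ) * ∑ t ∈ range K, curl B (z + (-((t : ℤ) + 1)) • unitVec ⟨0, h0⟩) ⟨0, h0⟩ μ ^ 2 :=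
          sum_le_sum fun z _ => sq_le_uniform_of_ne h0 B hax hout hK0 hμ z
      _ = (K : ℝ) * ∑ t ∈ range K, ∑ z ∈ E, curl B (z + (-((t : ℤ) + 1)) • unitVec ⟨0, h0⟩) ⟨0, h0⟩ μ ^ 2 := by
          rw [← mul_sum, sum_comm]
      _ ≤ (K : ℝ) * ∑ _t ∈ range K, R μ := by
          refine mul_le_mul_of_nonneg_left (sum_le_sum fun t _ => ?_) hK
          exact sum_shift_le (fun w => curl B w ⟨0, h0⟩ μ ^ 2) (fun _ => sq_nonneg _)
            (fun w hw => mem_plaqBox_of_ne h0 B hout (fun h => hw (by rw [h]; ring))) _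
      _ = (K : ℝ) ^ 2 * R μ := by rw [sum_const, card_range, nsmul_eq_mul]; ring
  -- (b) the direction `0`: `Σ_{x∈E} B(x,0)² ≤ 2K²·R 1 + 2K⁴·R 1`
  have hb : ∑ x ∈ E, B (x, ⟨0, h0⟩) ^ 2 ≤ (2 * (K : ℝ) ^ 2 + 2 * (K : ℝ) ^ 4) * R ⟨1, h1⟩ := by
    have hne : (⟨1, h1⟩ : Fin d) ≠ ⟨0, h0⟩ := by simp
    calc ∑ x ∈ E, B (x, ⟨0, h0⟩) ^ 2
        ≤ ∑ x ∈ E, (2 * K * ∑ j ∈ range K, curl B (x + (j : ℤ) • unitVec ⟨1, h1⟩) ⟨0, h0⟩ ⟨1, h1⟩ ^ 2 +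
            2 * K * ∑ j ∈ range K, B (x + (j : ℤ) • unitVec ⟨1, h1⟩, ⟨1, h1⟩) ^ 2) :=
          sum_le_sum fun x _ => sq_dir0_le_uniform h0 h1 B hax hout hK1 x
      _ = 2 * K * ∑ j ∈ range K, ∑ x ∈ E, curl B (x + (j : ℤ) • unitVec ⟨1, h1⟩) ⟨0, h0⟩ ⟨1, h1⟩ ^ 2 +
            2 * K * ∑ j ∈ range K, ∑ x ∈ E, B (x + (j : ℤ) • unitVec ⟨1, h1⟩, ⟨1, h1⟩) ^ 2 := by
          rw [sum_add_distrib, ← mul_sum, ← mul_sum, sum_comm, sum_comm (s := E)]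
      _ ≤ 2 * K * ∑ _j ∈ range K, R ⟨1, h1⟩ + 2 * K * ∑ _j ∈ range K, (K : ℝ) ^ 2 * R ⟨1, h1⟩ := by
          refine add_le_add (mul_le_mul_of_nonneg_left (sum_le_sum fun j _ => ?_) (by positivity))
            (mul_le_mul_of_nonneg_left (sum_le_sum fun j _ => ?_) (by positivity))
          · exact sum_shift_le (fun w => curl B w ⟨0, h0⟩ ⟨1, h1⟩ ^ 2) (fun _ => sq_nonneg _)
              (fun w hw => mem_plaqBox_of_ne h0 B hout (fun h => hw (by rw [h]; ring))) _
          · exact (sum_shift_le (fun w => B (w, ⟨1, h1⟩) ^ 2) (fun _ => sq_nonneg _)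
              (fun w hw => mem_bigBox_of_ne B hout (fun h => hw (by rw [h]; ring))) _).trans (ha ⟨1, h1⟩ hne)
      _ = (2 * (K : ℝ) ^ 2 + 2 * (K : ℝ) ^ 4) * R ⟨1, h1⟩ := by
          rw [sum_const, sum_const, card_range, nsmul_eq_mul, nsmul_eq_mul]; ring
  -- assembly
  have hsplit : ∑ z ∈ E, ∑ μ : Fin d, B (z, μ) ^ 2 = ∑ μ : Fin d, ∑ z ∈ E, B (z, μ) ^ 2 := sum_comm
  rw [hsplit, hRsum]
  have hsum_ne : ∑ μ ∈ (univ : Finset (Fin d)).erase ⟨0, h0⟩, ∑ z ∈ E, B (z, μ) ^ 2 ≤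
      ∑ μ ∈ (univ : Finset (Fin d)).erase ⟨0, h0⟩, (K : ℝ) ^ 2 * R μ :=
    sum_le_sum fun μ hμ => ha μ (ne_of_mem_erase hμ)
  have hRtot : R ⟨1, h1⟩ ≤ ∑ μ : Fin d, R μ := single_le_sum (fun μ _ => hRnn μ) (mem_univ _)
  have hRerase : ∑ μ ∈ (univ : Finset (Fin d)).erase ⟨0, h0⟩, (K : ℝ) ^ 2 * R μ ≤ (K : ℝ) ^ 2 * ∑ μ : Fin d, R μ := by
    rw [← mul_sum]
    exact mul_le_mul_of_nonneg_left (sum_le_sum_of_subset_of_nonneg (erase_subset _ _) fun μ _ _ => hRnn μ)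
      (by positivity)
  rw [← add_sum_erase _ _ (mem_univ (⟨0, h0⟩ : Fin d))]
  have hb' : ∑ x ∈ E, B (x, ⟨0, h0⟩) ^ 2 ≤ (2 * (K : ℝ) ^ 2 + 2 * (K : ℝ) ^ 4) * ∑ μ : Fin d, R μ :=
    hb.trans (mul_le_mul_of_nonneg_left hRtot (by positivity))
  have hrhs : (3 * (K : ℝ) ^ 2 + 2 * (K : ℝ) ^ 4) * ∑ μ : Fin d, R μ =
      (2 * (K : ℝ) ^ 2 + 2 * (K : ℝ) ^ 4) * ∑ μ : Fin d, R μ + (K : ℝ) ^ 2 * ∑ μ : Fin d, R μ := by ring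
  rw [hrhs]
  exact add_le_add hb' (hsum_ne.trans hRerase)

/-- Constant bookkeeping: for `d ≥ 4`, `M ≥ 1` and `K = 100M`, `3K² + 2K⁴ ≤ d·(100M)^{d+1}` — so the `x₁`-axial (1.8) holds in
the printed shape `B16Sect1Wilson.Ineq18` (whose constant `d(100M)^{d+1}` is the comb's). [cite: Balaban1989LargeFieldII, (1.8) p.358] -/
theorem const_le_printed (hd : 4 ≤ d) {M : ℕ} (hM : 1 ≤ M) :
    3 * ((100 * M : ℕ) : ℝ) ^ 2 + 2 * ((100 * M : ℕ) : ℝ) ^ 4 ≤ (d : ℝ) * (100 * (M : ℝ)) ^ (d + 1) := by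
  set K : ℝ := 100 * (M : ℝ) with hK
  have hK100 : (100 : ℝ) ≤ K := by
    have : (1 : ℝ) ≤ M := by exact_mod_cast hM
    rw [hK]; linarith
  have hK1 : (1 : ℝ) ≤ K := by linarith
  have hcast : ((100 * M : ℕ) : ℝ) = K := by rw [hK]; push_cast; ring
  rw [hcast]
  have hd' : (4 : ℝ) ≤ d := by exact_mod_cast hd
  -- `K^{d+1} = K^4 · K^{d-3}` and `K^{d-3} ≥ K ≥ 100`
  obtain ⟨e, he⟩ : ∃ e : ℕ, d + 1 = 4 + (e + 1) := ⟨d - 4, by omega⟩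
  have hpow : K ^ 4 * K ≤ K ^ (d + 1) := by
    rw [he, pow_add, pow_succ]
    refine mul_le_mul_of_nonneg_left ?_ (by positivity)
    calc K = 1 * K := (one_mul K).symm
      _ ≤ K ^ e * K := mul_le_mul_of_nonneg_right (one_le_pow₀ hK1) (by positivity)
  have hK2 : K ^ 2 ≤ K ^ 4 := pow_le_pow_right₀ hK1 (by norm_num)
  have hK4 : 0 ≤ K ^ 4 := by positivity
  calc 3 * K ^ 2 + 2 * K ^ 4 ≤ 5 * K ^ 4 := by linarith
    _ ≤ K ^ 4 * K := by nlinarith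
    _ ≤ 1 * K ^ (d + 1) := by rw [one_mul]; exact hpow
    _ ≤ (d : ℝ) * K ^ (d + 1) := mul_le_mul_of_nonneg_right (by linarith) (by positivity)

/-- **THE `x₁`-AXIAL (1.8) IN THE PRINTED SHAPE** (`d ≥ 4`, print's `d = 4`; sides `≤ 100M`): `B16Sect1Wilson.Ineq18 (Σ_b B(b)²)
(Σ_p (∂B)(p)²) d M` for a real bond field supported on the bonds meeting `Λ` in the `x₁`-axial gauge.
[cite: Balaban1989LargeFieldII, (1.8) p.358] -/
theorem ineq18_axial_printed (hd : 4 ≤ d) (h1 : 1 < d) (M : ℕ) (hM : 1 ≤ M) (hn : ∀ i, n i ≤ 100 * M) (B : Cfg d)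
    (hax : ∀ x ∈ box n y, B (x - unitVec ⟨0, h0⟩, ⟨0, h0⟩) = 0)
    (hout : ∀ (z : Fin d → ℤ) (μ : Fin d), z ∉ box n y → z + unitVec μ ∉ box n y → B (z, μ) = 0) :
    B16Sect1Wilson.Ineq18 (∑ z ∈ box (fun i => n i + 2) (fun i => y i - 1), ∑ μ : Fin d, B (z, μ) ^ 2)
      (∑ z ∈ box (fun i => n i + 3) (fun i => y i - 2), ∑ μ : Fin d, curl B z ⟨0, h0⟩ μ ^ 2) d M := by
  unfold B16Sect1Wilson.Ineq18
  have h := ineq18_axial h0 h1 B hax hout (hn ⟨0, h0⟩) (hn ⟨1, h1⟩)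
  have hnn : 0 ≤ ∑ z ∈ box (fun i => n i + 3) (fun i => y i - 2), ∑ μ : Fin d, curl B z ⟨0, h0⟩ μ ^ 2 :=
    sum_nonneg fun _ _ => sum_nonneg fun _ _ => sq_nonneg _
  exact h.trans (mul_le_mul_of_nonneg_right (const_le_printed hd hM) hnn)

/-- **The `x₁`-axial (1.8), 𝔤-VALUED** (componentwise in coordinates `a : Fin D` of an orthonormal basis, `|B′(b)|² = Σ_a B′_a(b)²`,
as `B16Eq18Proof.ineq18_box_vec`). [cite: Balaban1989LargeFieldII, (1.8) p.358] -/
theorem ineq18_axial_vec (h1 : 1 < d) {D : ℕ} (B : (Fin d → ℤ) × Fin d → (Fin D → ℝ))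
    (hax : ∀ x ∈ box n y, B (x - unitVec ⟨0, h0⟩, ⟨0, h0⟩) = 0)
    (hout : ∀ (z : Fin d → ℤ) (μ : Fin d), z ∉ box n y → z + unitVec μ ∉ box n y → B (z, μ) = 0)
    {K : ℕ} (hK0 : n ⟨0, h0⟩ ≤ K) (hK1 : n ⟨1, h1⟩ ≤ K) :
    ∑ z ∈ box (fun i => n i + 2) (fun i => y i - 1), ∑ μ : Fin d, ∑ a, B (z, μ) a ^ 2 ≤
      (3 * (K : ℝ) ^ 2 + 2 * (K : ℝ) ^ 4) *
        ∑ z ∈ box (fun i => n i + 3) (fun i => y i - 2), ∑ μ : Fin d, ∑ a, curl (fun b => B b a) z ⟨0, h0⟩ μ ^ 2 := by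
  have hcomp : ∀ a : Fin D,
      ∑ z ∈ box (fun i => n i + 2) (fun i => y i - 1), ∑ μ : Fin d, B (z, μ) a ^ 2 ≤
        (3 * (K : ℝ) ^ 2 + 2 * (K : ℝ) ^ 4) *
          ∑ z ∈ box (fun i => n i + 3) (fun i => y i - 2), ∑ μ : Fin d, curl (fun b => B b a) z ⟨0, h0⟩ μ ^ 2 :=
    fun a => ineq18_axial h0 h1 (fun b => B b a) (fun x hx => by simp [hax x hx]) (fun z μ hz hμ => by simp [hout z μ hz hμ]) hK0 hK1
  have hswap1 : ∀ z ∈ box (fun i => n i + 2) (fun i => y i - 1),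
      ∑ μ : Fin d, ∑ a : Fin D, B (z, μ) a ^ 2 = ∑ a : Fin D, ∑ μ : Fin d, B (z, μ) a ^ 2 := fun z _ => sum_comm
  have hswap2 : ∀ z ∈ box (fun i => n i + 3) (fun i => y i - 2),
      ∑ a : Fin D, ∑ μ : Fin d, curl (fun b => B b a) z ⟨0, h0⟩ μ ^ 2 =
        ∑ μ : Fin d, ∑ a : Fin D, curl (fun b => B b a) z ⟨0, h0⟩ μ ^ 2 := fun z _ => sum_comm
  calc ∑ z ∈ box (fun i => n i + 2) (fun i => y i - 1), ∑ μ : Fin d, ∑ a, B (z, μ) a ^ 2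
      = ∑ a, ∑ z ∈ box (fun i => n i + 2) (fun i => y i - 1), ∑ μ : Fin d, B (z, μ) a ^ 2 := by
        rw [sum_congr rfl hswap1, sum_comm]
    _ ≤ ∑ a : Fin D, (3 * (K : ℝ) ^ 2 + 2 * (K : ℝ) ^ 4) *
          ∑ z ∈ box (fun i => n i + 3) (fun i => y i - 2), ∑ μ : Fin d, curl (fun b => B b a) z ⟨0, h0⟩ μ ^ 2 :=
        sum_le_sum fun a _ => hcomp a
    _ = _ := by
        rw [← mul_sum, sum_comm, sum_congr rfl hswap2]

end L2

end

end Literature.MathematicalPhysics.QuantumFieldTheory.Balaban1983to89.B16Ineq18AxialGauge
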